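import Literature.AlgebraicGeometry.HodgeTheory.GlZariskiClosureMatrixBridge
import Literature.AlgebraicGeometry.HodgeTheory.GlZariskiClosurePolynomialMap
import Literature.NumberTheory.Automorphic.AlgebraicHomImages
import HarnessLib

/-!
# Images of `Δ^Zar(K)` and of `(Δ^Zar)°(K)` under rational homomorphisms are CLOSED: the closure of the
# image is the image of the closure, and the identity component of the image is the image of the identity
# component (Springer 2.2.5 (ii), (iv), transported to the basis-free vocabulary; `K` algebraically closed)

Family `hodge`, layer `Literature/AlgebraicGeometry/HodgeTheory`. THEOREMS only. The tree's
`GlZariskiClosurePolynomialMap` / `ZariskiClosureRationalMap` give the EASY inclusions `Φ(Γ^Zar) ⊆ (ΦΓ)^Zar`,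
`Φ((Γ^Zar)°) ⊆ ((ΦΓ)^Zar)°` for maps `Φ` with a `K[x, 1/det]` matrix formula (Borel I.2.1 (c)). This file adds
the HARD inclusions over an algebraically closed field — Springer 2.2.5: *"(ii) `φG` is a closed subgroup of
`G'`. […] (iv) `φ(G°) = (φG)°`"* — by transport along the bridge `GlZariskiClosureMatrixBridge` to the
algebraic-group library `Literature/NumberTheory/Automorphic`, where the closed-image theorem
(`MonoidHom.IsAlgebraicGL.isAlgebraicSubgroup_range`, via Chevalley's constructibility theorem) and the
identity component of an image (`…isAlgebraicSubgroup_map_of_le`, `…isZConnected_map_of_le`,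
`identityComponent_le_of_finiteIndex`) are proved.

Setting: `V`, `V'` finite-dimensional over an algebraically closed field `K`, bases `b`, `b'`; a subgroup
`Γ ≤ GL(V)`; a group homomorphism `φ : Γ^Zar(K) → GL(V')` (on the closure subgroup
`glZariskiClosureSubgroup Γ`) whose matrix is a fixed matrix `F` of rational functions `K[x_{ij}][1/det]`
evaluated at the matrix of the argument (`evalAtInvDet`); `φΓ` denotes the image of `Γ`.

* `glZariskiClosure_map_image` — the four inclusions at once; corollaries:
  `exists_eq_of_mem_glZariskiClosure_map` (**`(φΓ)^Zar ⊆ φ(Γ^Zar)`**),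
  `map_mem_glZariskiClosure_map` (`φ(Γ^Zar) ⊆ (φΓ)^Zar`),
  `exists_eq_of_mem_glIdentityComponent_map` (**`((φΓ)^Zar)° ⊆ φ((Γ^Zar)°)`**),
  `map_mem_glIdentityComponent_map` (`φ((Γ^Zar)°) ⊆ ((φΓ)^Zar)°`).

Use (crux K1 of `Summits/HodgeConjecture/HodgeConjecture/Theses/CyclicUnitaryPowers.lean`, Goursat core of the
Katz fact, `GoursatKolchinRibetKernels`): with `φ` a block projection of a block-diagonal monodromy closure,
`((ρᵢΓ)^Zar)° = ρᵢ((Γ^Zar)°)` turns hypothesis (1′) of `Katz1990_goursatKolchinRibet_specialLinear'` into the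
lift form (1) of `Katz1990_goursatKolchinRibet_specialLinear` (Katz's "`G°` maps onto each `Gᵢ°`").
Written by the prover seat `hodge-nonav-prover-Ax` (cell `hodge-nonav`).

## References
* [SpringerLAG1998] T. A. Springer, *Linear Algebraic Groups*, 2nd ed. (1998), 2.1.4, 2.2.1, 2.2.5 (ii), (iv).
* [Borel1991] A. Borel, *Linear Algebraic Groups*, 2nd ed. (1991), I.1.7, I.2.1 (b), (c).
* [Katz1990ESDE] N. M. Katz, *Exponential Sums and Differential Equations* (1990), §1.8, proof of Prop. 1.8.2,
  first paragraph ("`G°` maps onto each `Gᵢ°`").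
-/

noncomputable section

open Module Literature.AlgebraicGeometry.Motives
open scoped MatrixGroups

namespace Literature.AlgebraicGeometry.HodgeTheory

universe u v v' w w'

variable {K : Type u} [Field K] [IsAlgClosed K] {V : Type v} [AddCommGroup V] [Module K V] [Module.Finite K V]
  {V' : Type v'} [AddCommGroup V'] [Module K V'] [Module.Finite K V']
variable {ι : Type w} [Fintype ι] [DecidableEq ι] {ι' : Type w'} [Fintype ι'] [DecidableEq ι']

omit [IsAlgClosed K] [Module.Finite K V] in
/-- `K[x_{ij}][y] → K[x_{ij}, y]`: a rational function `Q(x, 1/det x) ∈ K[x_{ij}][y]` (the tree's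
`evalAtInvDet` calculus) is a polynomial in the affine coordinates `x_{ij}, det⁻¹` of `GL_n`
(`Literature/NumberTheory/Automorphic`), with the same values. [cite: Borel1991, I.1.7] -/
private theorem exists_eval_glCoordFun_eq_evalAtInvDet :
    ∃ θ : Polynomial (MvPolynomial (ι × ι) K) →+* MvPolynomial (Literature.NumberTheory.Automorphic.GLCoord ι) K,
      ∀ (x : GL ι K) (Q : Polynomial (MvPolynomial (ι × ι) K)),
        MvPolynomial.eval (Literature.NumberTheory.Automorphic.glCoordFun x) (θ Q) = evalAtInvDet (x : Matrix ι ι K) Q := by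
  let θ : Polynomial (MvPolynomial (ι × ι) K) →+* MvPolynomial (Literature.NumberTheory.Automorphic.GLCoord ι) K :=
    Polynomial.eval₂RingHom (MvPolynomial.rename Sum.inl : MvPolynomial (ι × ι) K →ₐ[K]
      MvPolynomial (Literature.NumberTheory.Automorphic.GLCoord ι) K).toRingHom (MvPolynomial.X (Sum.inr ()))
  refine ⟨θ, fun x Q => ?_⟩
  have hcomp : (MvPolynomial.eval (Literature.NumberTheory.Automorphic.glCoordFun x)).comp θ =
      evalAtInvDet (x : Matrix ι ι K) := by
    refine Polynomial.ringHom_ext (fun q => ?_) ?_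
    · rw [RingHom.comp_apply, evalAtInvDet_C]
      change MvPolynomial.eval _ (Polynomial.eval₂ _ _ (Polynomial.C q)) = _
      rw [Polynomial.eval₂_C, AlgHom.toRingHom_eq_coe, RingHom.coe_coe, MvPolynomial.eval_rename]
      rfl
    · rw [RingHom.comp_apply, evalAtInvDet_X]
      change MvPolynomial.eval _ (Polynomial.eval₂ _ _ Polynomial.X) = _
      rw [Polynomial.eval₂_X, MvPolynomial.eval_X, Literature.NumberTheory.Automorphic.glCoordFun_inr]
  rw [← hcomp, RingHom.comp_apply]

/-- **Springer 2.2.5 (ii), (iv) for the basis-free closures**: let `φ : Γ^Zar(K) → GL(V')` be a group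
homomorphism on the closure subgroup of `Γ ≤ GL(V)` with a `K[x, 1/det]` matrix formula `F`
(`[φ g]_{b'} = F([g]_b, 1/det [g]_b)`), `K` algebraically closed, and let `φΓ ≤ GL(V')` be the image of `Γ`.
Then (i) `φ(Γ^Zar) ⊆ (φΓ)^Zar`, (ii) `(φΓ)^Zar ⊆ φ(Γ^Zar)` (the image of the algebraic group `Γ^Zar` is
CLOSED), (iii) `φ((Γ^Zar)°) ⊆ ((φΓ)^Zar)°`, (iv) `((φΓ)^Zar)° ⊆ φ((Γ^Zar)°)`.  Proof: choose matrix
isomorphisms `Ψ`, `Ψ'` (`GlZariskiClosureMatrixBridge`); `f = Ψ' ∘ φ ∘ Ψ⁻¹` is an algebraic homomorphism on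
the algebraic group `G = zariskiClosure (Ψ Γ)` (its `det⁻¹`-coordinate is `det f(g⁻¹)`, polynomial via
`invPolyGL`), so `f(G)` is algebraic (Chevalley–Springer 2.2.5 (ii)) and, `f` being continuous,
`f(G) = zariskiClosure (Ψ' φΓ)`; `f(G°)` is connected algebraic of finite index in `f(G)`, hence equals its
identity component (2.2.1). [cite: SpringerLAG1998, 2.2.5 (ii), (iv)] [cite: Borel1991, I.2.1] -/
theorem glZariskiClosure_map_image (b : Module.Basis ι K V) (b' : Module.Basis ι' K V')
    (Γ : Subgroup (V ≃ₗ[K] V)) (φ : glZariskiClosureSubgroup Γ →* (V' ≃ₗ[K] V'))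
    (F : Matrix ι' ι' (Polynomial (MvPolynomial (ι × ι) K)))
    (hφ : ∀ g : glZariskiClosureSubgroup Γ, LinearMap.toMatrix b' b' ((φ g : V' ≃ₗ[K] V') : V' →ₗ[K] V') =
      (evalAtInvDet (LinearMap.toMatrix b b ((g : V ≃ₗ[K] V) : V →ₗ[K] V))).mapMatrix F) :
    (∀ g : glZariskiClosureSubgroup Γ,
        φ g ∈ glZariskiClosure ((Γ.subgroupOf (glZariskiClosureSubgroup Γ)).map φ)) ∧
      (∀ y ∈ glZariskiClosure ((Γ.subgroupOf (glZariskiClosureSubgroup Γ)).map φ),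
        ∃ g : glZariskiClosureSubgroup Γ, φ g = y) ∧
      (∀ g : glZariskiClosureSubgroup Γ, (g : V ≃ₗ[K] V) ∈ glIdentityComponent Γ →
        φ g ∈ glIdentityComponent ((Γ.subgroupOf (glZariskiClosureSubgroup Γ)).map φ)) ∧
      (∀ y ∈ glIdentityComponent ((Γ.subgroupOf (glZariskiClosureSubgroup Γ)).map φ),
        ∃ g : glZariskiClosureSubgroup Γ, (g : V ≃ₗ[K] V) ∈ glIdentityComponent Γ ∧ φ g = y) := by
  classical
  letI := Literature.NumberTheory.Automorphic.zariskiTopologyGL ι K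
  letI := Literature.NumberTheory.Automorphic.zariskiTopologyGL ι' K
  obtain ⟨Ψ, hΨ⟩ := exists_mulEquiv_coe_eq_toMatrix b
  obtain ⟨Ψ', hΨ'⟩ := exists_mulEquiv_coe_eq_toMatrix b'
  obtain ⟨θ, hθ⟩ := exists_eval_glCoordFun_eq_evalAtInvDet (K := K) (ι := ι)
  set Φ : Subgroup (V' ≃ₗ[K] V') := (Γ.subgroupOf (glZariskiClosureSubgroup Γ)).map φ with hΦdef
  -- the matrix groups
  set G := Literature.NumberTheory.Automorphic.zariskiClosure (Γ.map Ψ.toMonoidHom) with hG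
  have hGalg : Literature.NumberTheory.Automorphic.IsAlgebraicSubgroup G :=
    Literature.NumberTheory.Automorphic.isAlgebraicSubgroup_zariskiClosure _
  have hGmem : ∀ x : GL ι K, x ∈ G ↔ Ψ.symm x ∈ glZariskiClosure Γ := by
    intro x
    rw [mem_glZariskiClosure_iff_mem_zariskiClosure b Ψ hΨ, MulEquiv.apply_symm_apply]
  -- `e : G → Γ^Zar`, `g ↦ Ψ⁻¹ g`, and `f = Ψ' ∘ φ ∘ e`
  let e : G →* glZariskiClosureSubgroup Γ :=
    MonoidHom.mk' (fun g => ⟨Ψ.symm (g : GL ι K), (hGmem g).1 g.2⟩) fun x y =>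
      Subtype.ext (by simp only [Subgroup.coe_mul, map_mul])
  have he : ∀ g : G, ((e g : glZariskiClosureSubgroup Γ) : V ≃ₗ[K] V) = Ψ.symm (g : GL ι K) := fun g => rfl
  let f : G →* GL ι' K := Ψ'.toMonoidHom.comp (φ.comp e)
  have hf_apply : ∀ g : G, f g = Ψ' (φ (e g)) := fun g => rfl
  -- entries of `f g`
  have hentry : ∀ (g : G) (k l : ι'), (f g : Matrix ι' ι' K) k l =
      MvPolynomial.eval (Literature.NumberTheory.Automorphic.glCoordFun (g : GL ι K)) (θ (F k l)) := by
    intro g k l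
    rw [hf_apply, hΨ', hφ, he, hθ, ← hΨ, MulEquiv.apply_symm_apply, RingHom.mapMatrix_apply, Matrix.map_apply]
  -- `f` is algebraic
  have hf : Literature.NumberTheory.Automorphic.MonoidHom.IsAlgebraicGL f := by
    refine ⟨Sum.elim (fun kl => θ (F kl.1 kl.2)) fun _ =>
      (Matrix.of fun k l => MvPolynomial.bind₁ Literature.NumberTheory.Automorphic.invPolyGL (θ (F k l))).det,
      fun g c => ?_⟩
    rcases c with ⟨k, l⟩ | u
    · rw [Literature.NumberTheory.Automorphic.glCoordFun_inl, Sum.elim_inl, hentry]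
    · rw [Literature.NumberTheory.Automorphic.glCoordFun_inr, Sum.elim_inr, RingHom.map_det, RingHom.mapMatrix_apply]
      -- `(det (f g))⁻¹ = det (f g⁻¹)`, and the entries of `f g⁻¹` are polynomials in the coordinates of `g`
      have hinv : (Matrix.det (f g : Matrix ι' ι' K))⁻¹ = Matrix.det ((f g⁻¹ : GL ι' K) : Matrix ι' ι' K) := by
        rw [map_inv, Matrix.coe_units_inv, Matrix.det_nonsing_inv, Ring.inverse_eq_inv']
      rw [hinv]
      congr 1
      ext k l
      rw [Matrix.map_apply, Matrix.of_apply, Literature.NumberTheory.Automorphic.eval_bind₁, hentry]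
      exact congrArg (fun c => MvPolynomial.eval c (θ (F k l)))
        (funext fun c => (Literature.NumberTheory.Automorphic.eval_invPolyGL (g : GL ι K) c).symm)
  -- the closure `L` of `Ψ' φΓ` equals the range `R` of `f`
  set L := Literature.NumberTheory.Automorphic.zariskiClosure (Φ.map Ψ'.toMonoidHom) with hL
  have hLalg : Literature.NumberTheory.Automorphic.IsAlgebraicSubgroup L :=
    Literature.NumberTheory.Automorphic.isAlgebraicSubgroup_zariskiClosure _
  have hRalg : Literature.NumberTheory.Automorphic.IsAlgebraicSubgroup f.range := hf.isAlgebraicSubgroup_range hGalg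
  -- the subset `T ⊆ G` of the points of `Ψ Γ`
  set T : Set G := {x | ((x : GL ι K) : GL ι K) ∈ Γ.map Ψ.toMonoidHom} with hT
  have hTΓ : ∀ x : G, x ∈ T → ((e x : glZariskiClosureSubgroup Γ) : V ≃ₗ[K] V) ∈ Γ := by
    intro x hx
    rw [he]
    exact Subgroup.mem_map_equiv.1 hx
  have hfT : f '' T ⊆ ((Φ.map Ψ'.toMonoidHom : Subgroup (GL ι' K)) : Set (GL ι' K)) := by
    rintro _ ⟨x, hx, rfl⟩
    refine ⟨φ (e x), ⟨e x, Subgroup.mem_subgroupOf.2 (hTΓ x hx), rfl⟩, rfl⟩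
  have hLR : L = f.range := by
    refine le_antisymm (Literature.NumberTheory.Automorphic.zariskiClosure_le hRalg ?_) ?_
    · rintro _ ⟨y, ⟨c, hc, rfl⟩, rfl⟩
      -- `Ψ' (φ c) = f (Ψ c)`
      have hcΓ : (c : V ≃ₗ[K] V) ∈ Γ := Subgroup.mem_subgroupOf.1 hc
      have hΨc : Ψ (c : V ≃ₗ[K] V) ∈ G := Literature.NumberTheory.Automorphic.le_zariskiClosure _ ⟨c, hcΓ, rfl⟩
      have heq : e ⟨Ψ (c : V ≃ₗ[K] V), hΨc⟩ = c := Subtype.ext (by rw [he]; exact Ψ.symm_apply_apply _)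
      refine ⟨⟨Ψ c, hΨc⟩, ?_⟩
      change f ⟨Ψ (c : V ≃ₗ[K] V), hΨc⟩ = Ψ' (φ c)
      rw [hf_apply, heq]
    · rintro _ ⟨g, rfl⟩
      -- `g ∈ closure T` in the subspace `G`, and `f` is continuous
      have hgT : g ∈ closure T := by
        rw [Topology.IsInducing.subtypeVal.closure_eq_preimage_closure_image, Set.mem_preimage]
        have hsub : (((Γ.map Ψ.toMonoidHom : Subgroup (GL ι K)) : Set (GL ι K))) ⊆ Subtype.val '' T := fun x hx =>
          ⟨⟨x, Literature.NumberTheory.Automorphic.le_zariskiClosure _ hx⟩, hx, rfl⟩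
        exact closure_mono hsub (Literature.NumberTheory.Automorphic.mem_zariskiClosure_iff.1 g.2)
      have h1 := image_closure_subset_closure_image hf.continuous ⟨g, hgT, rfl⟩
      exact closure_mono hfT h1
  -- (ii): `(φΓ)^Zar ⊆ φ(Γ^Zar)`
  have h2 : ∀ y ∈ glZariskiClosure Φ, ∃ g : glZariskiClosureSubgroup Γ, φ g = y := by
    intro y hy
    rw [mem_glZariskiClosure_iff_mem_zariskiClosure b' Ψ' hΨ', ← hL, hLR] at hy
    obtain ⟨g, hg⟩ := hy
    exact ⟨e g, Ψ'.injective (by rw [← hf_apply]; exact hg)⟩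
  -- (i): `φ(Γ^Zar) ⊆ (φΓ)^Zar`
  have h1 : ∀ g : glZariskiClosureSubgroup Γ, φ g ∈ glZariskiClosure Φ := by
    intro g
    have hx : Ψ (g : V ≃ₗ[K] V) ∈ G := by
      rw [hGmem, MulEquiv.symm_apply_apply]; exact g.2
    have heg : e ⟨Ψ g, hx⟩ = g := Subtype.ext (by rw [he]; exact Ψ.symm_apply_apply _)
    rw [mem_glZariskiClosure_iff_mem_zariskiClosure b' Ψ' hΨ', ← hL, hLR]
    exact ⟨⟨Ψ g, hx⟩, by rw [hf_apply, heg]⟩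
  -- identity components: `f(G°)` is connected algebraic of finite index in `L`
  set G0 := Literature.NumberTheory.Automorphic.identityComponent G with hG0
  set fG0 : Subgroup (GL ι' K) := (G0.subgroupOf G).map f with hfG0
  have hfG0alg : Literature.NumberTheory.Automorphic.IsAlgebraicSubgroup fG0 :=
    hf.isAlgebraicSubgroup_map_of_le (Literature.NumberTheory.Automorphic.isAlgebraicSubgroup_identityComponent hGalg)
      (Literature.NumberTheory.Automorphic.identityComponent_le G)
  have hfG0conn : Literature.NumberTheory.Automorphic.IsZConnected fG0 :=
    hf.isZConnected_map_of_le (Literature.NumberTheory.Automorphic.isZConnected_identityComponent hGalg)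
      (Literature.NumberTheory.Automorphic.identityComponent_le G)
  have hfG0L : fG0 ≤ L := by
    rw [hLR]
    rintro _ ⟨g, _, rfl⟩
    exact ⟨g, rfl⟩
  have hfG0fi : (fG0.subgroupOf L).FiniteIndex := by
    have hfi : ((G0.subgroupOf G).subgroupOf (⊤ : Subgroup G)).FiniteIndex := by
      refine ⟨?_⟩
      change (G0.subgroupOf G).relIndex ⊤ ≠ 0
      rw [Subgroup.relIndex_top_right]
      exact (Literature.NumberTheory.Automorphic.finiteIndex_identityComponent hGalg).index_ne_zero
    have h := finiteIndex_map_subgroupOf f hfi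
    rwa [← MonoidHom.range_eq_map, ← hLR] at h
  have hL0 : Literature.NumberTheory.Automorphic.identityComponent L ≤ fG0 :=
    Literature.NumberTheory.Automorphic.identityComponent_le_of_finiteIndex hfG0L hfG0alg hfG0fi
  have hL0' : fG0 ≤ Literature.NumberTheory.Automorphic.identityComponent L :=
    hfG0conn.le_of_finiteIndex hfG0L (Literature.NumberTheory.Automorphic.isAlgebraicSubgroup_identityComponent hLalg)
      (Literature.NumberTheory.Automorphic.finiteIndex_identityComponent hLalg)
  -- (iv): `((φΓ)^Zar)° ⊆ φ((Γ^Zar)°)`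
  have h4 : ∀ y ∈ glIdentityComponent Φ,
      ∃ g : glZariskiClosureSubgroup Γ, (g : V ≃ₗ[K] V) ∈ glIdentityComponent Γ ∧ φ g = y := by
    intro y hy
    rw [mem_glIdentityComponent_iff_mem_identityComponent b' Ψ' hΨ', ← hL] at hy
    obtain ⟨g, hg0, hg⟩ := hL0 hy
    refine ⟨e g, ?_, Ψ'.injective (by rw [← hf_apply]; exact hg)⟩
    rw [he]
    exact (symm_mem_glIdentityComponent_iff b Ψ hΨ Γ (g : GL ι K)).2 (Subgroup.mem_subgroupOf.1 hg0)
  -- (iii): `φ((Γ^Zar)°) ⊆ ((φΓ)^Zar)°`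
  have h3 : ∀ g : glZariskiClosureSubgroup Γ, (g : V ≃ₗ[K] V) ∈ glIdentityComponent Γ →
      φ g ∈ glIdentityComponent Φ := by
    intro g hg
    have hx : Ψ (g : V ≃ₗ[K] V) ∈ G := by
      rw [hGmem, MulEquiv.symm_apply_apply]; exact g.2
    have hx0 : (⟨Ψ g, hx⟩ : G) ∈ G0.subgroupOf G := by
      rw [Subgroup.mem_subgroupOf]
      exact (mem_glIdentityComponent_iff_mem_identityComponent b Ψ hΨ Γ (g : V ≃ₗ[K] V)).1 hg
    have heg : e ⟨Ψ g, hx⟩ = g := Subtype.ext (by rw [he]; exact Ψ.symm_apply_apply _)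
    rw [mem_glIdentityComponent_iff_mem_identityComponent b' Ψ' hΨ', ← hL]
    refine hL0' ⟨⟨Ψ g, hx⟩, hx0, ?_⟩
    rw [hf_apply, heg]
  exact ⟨h1, h2, h3, h4⟩

section Corollaries

variable (b : Module.Basis ι K V) (b' : Module.Basis ι' K V') (Γ : Subgroup (V ≃ₗ[K] V))
  (φ : glZariskiClosureSubgroup Γ →* (V' ≃ₗ[K] V')) (F : Matrix ι' ι' (Polynomial (MvPolynomial (ι × ι) K)))
  (hφ : ∀ g : glZariskiClosureSubgroup Γ, LinearMap.toMatrix b' b' ((φ g : V' ≃ₗ[K] V') : V' →ₗ[K] V') =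
    (evalAtInvDet (LinearMap.toMatrix b b ((g : V ≃ₗ[K] V) : V →ₗ[K] V))).mapMatrix F)

include hφ in
/-- **The image of `Γ^Zar(K)` is closed: `(φΓ)^Zar(K) ⊆ φ(Γ^Zar(K))`** (Springer 2.2.5 (ii), `K`
algebraically closed). [cite: SpringerLAG1998, 2.2.5 (ii)] -/
theorem exists_eq_of_mem_glZariskiClosure_map {y : V' ≃ₗ[K] V'}
    (hy : y ∈ glZariskiClosure ((Γ.subgroupOf (glZariskiClosureSubgroup Γ)).map φ)) :
    ∃ g : glZariskiClosureSubgroup Γ, φ g = y :=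
  (glZariskiClosure_map_image b b' Γ φ F hφ).2.1 y hy

include hφ in
/-- `φ(Γ^Zar(K)) ⊆ (φΓ)^Zar(K)` (the easy inclusion, Borel I.2.1 (c)). [cite: Borel1991, I.2.1] -/
theorem map_mem_glZariskiClosure_map (g : glZariskiClosureSubgroup Γ) :
    φ g ∈ glZariskiClosure ((Γ.subgroupOf (glZariskiClosureSubgroup Γ)).map φ) :=
  (glZariskiClosure_map_image b b' Γ φ F hφ).1 g

include hφ in
/-- **The identity component of the image is the image of the identity component:
`((φΓ)^Zar)°(K) ⊆ φ((Γ^Zar)°(K))`** (Springer 2.2.5 (iv) "`φ(G°) = (φG)°`", `K` algebraically closed; Katz's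
"`G°` maps onto each `Gᵢ°`"). [cite: SpringerLAG1998, 2.2.5 (iv)] [cite: Katz1990ESDE, §1.8 Prop. 1.8.2 (proof)] -/
theorem exists_eq_of_mem_glIdentityComponent_map {y : V' ≃ₗ[K] V'}
    (hy : y ∈ glIdentityComponent ((Γ.subgroupOf (glZariskiClosureSubgroup Γ)).map φ)) :
    ∃ g : glZariskiClosureSubgroup Γ, (g : V ≃ₗ[K] V) ∈ glIdentityComponent Γ ∧ φ g = y :=
  (glZariskiClosure_map_image b b' Γ φ F hφ).2.2.2 y hy

include hφ in
/-- `φ((Γ^Zar)°(K)) ⊆ ((φΓ)^Zar)°(K)` (Springer 2.2.5 (iv), the inclusion `φ(G°) ⊆ (φG)°`).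
[cite: SpringerLAG1998, 2.2.5 (iv)] -/
theorem map_mem_glIdentityComponent_map (g : glZariskiClosureSubgroup Γ)
    (hg : (g : V ≃ₗ[K] V) ∈ glIdentityComponent Γ) :
    φ g ∈ glIdentityComponent ((Γ.subgroupOf (glZariskiClosureSubgroup Γ)).map φ) :=
  (glZariskiClosure_map_image b b' Γ φ F hφ).2.2.1 g hg

end Corollaries

end Literature.AlgebraicGeometry.HodgeTheory

end
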